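import Mathlib
import Literature.Computability.AlgebraicComplexity.NestFreeMatchingPoly
import Literature.Computability.AlgebraicComplexity.CircuitDepthProofs
import Literature.Computability.AlgebraicComplexity.QuasiPolynomialFormulasProofs
import Summits.ValiantsHypothesis.ValiantsHypothesis.Theorems.FifoMatchingNCInVPCircuit
import Summits.ValiantsHypothesis.ValiantsHypothesis.Theorems.FifoMatchingNCMatchingSum
import Summits.ValiantsHypothesis.ValiantsHypothesis.Theorems.FifoMatchingNCInVP
import Summits.ValiantsHypothesis.ValiantsHypothesis.Theorems.FifoMatchingNNFormulaDivisionHard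
import HarnessLib

/-!
# One stack, one queue — in the monotone FORMULA-WITH-DIVISION model the twins `NC_n` / `NN_n` are
# PROVABLY separated: quasi-polynomial versus exponential

Route `ValiantsHypothesis/FifoMatching` (thesis: the noncrossing = STACK matching family `NC_n` is easy, the nest-free =
QUEUE matching family `NN_n` is hard), helper toward crux stmt-ValiantsHypothesis-21181 `NNDivisionHard`.

The route records the twin separation in two models: over `ℂ` it is the OPEN thesis (`NCInVP` proved, `NNNotVP` open);
for monotone CIRCUITS WITHOUT division it is a theorem (`L₊(NC_n) = O(n³)` by the interval DP, `L₊(NN_n) ≥ 2^{n^ε}`);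
for monotone circuits WITH division (the currency of 21181) the queue side is OPEN.  This file adds the strongest
division-allowing model in which the separation is a THEOREM today — monotone fan-in-two FORMULAS over `ℝ≥0` with one
division (Hrubeš–Yehudayoff normal form `f · h = g`, size `E₊(f·h) + E₊(h)`, `E₊ = formulaComplexity`):

* `noncrossingMatchingPoly_eq_ncRec` — over ANY commutative semiring, the library polynomial `NC_n`
  (`noncrossingMatchingPoly n k`) is the interval-DP value `ncRec k n 0 (2n)` (the tree's first-arc decomposition
  `sum_wt_eq`; the `ℂ` instance is `sum_matchings_eq_ncRec`);
* `complexity_noncrossingMatchingPoly_le`, `totalDegree_noncrossingMatchingPoly_le` — hence `L(NC_n) ≤ 4(2n+1)³`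
  over any commutative semiring (in particular MONOTONE circuits, `k = ℝ≥0`) and `deg NC_n ≤ 2n`;
* ★ `formulaComplexity_noncrossingMatchingPoly_le` — by the tree's balancing theorem (`formulaComplexity_le_two_pow`,
  BCS (21.35)/(21.36), valid over commutative semirings) `E(NC_n) ≤ 2^{18 (3 log₂ n + 8)²} = n^{O(log n)}` over any
  commutative semiring: the STACK twin has quasi-polynomial monotone formulas (no division needed);
* ★★ `stack_queue_formulaDivision_separation` — eventually in `n`: the certificate `h = 1` gives
  `E₊(NC_n · 1) + E₊(1) ≤ 2^{18 (3 log₂ n + 8)²}`, while EVERY certificate of the queue twin costs more: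
  `2^{18 (3 log₂ n + 8)²} < 2^{⌊n^{1/8}⌋} < E₊(NN_n · h) + E₊(h)` for all `h ≠ 0`
  (`FormulaDivision.formulaExpRung_holds`, the located-face shadow chain + HY21 Thm 42).

HONEST FRAMING: quasi-polynomial vs exponential, monotone FORMULA model; it is not claimed that `NC_n` has polynomial
monotone formulas; nothing here bears on the circuit-model crux 21181, on `NNNotVP`, or on VP ≠ VNP (NOT proved).

References: Hrubeš–Yehudayoff, *Shadows of Newton polytopes*, CCC 2021, Thm 42 / §6 [HrubesYehudayoff2021];
Bürgisser–Clausen–Shokrollahi, *Algebraic Complexity Theory* (1997) (21.35)/(21.36) [BurgisserClausenShokrollahi1997];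
Chen–Deng–Du–Stanley–Yan, Trans. AMS 359 (2007) §1 (noncrossing / nonnesting matchings) [ChenDengDuStanleyYan2007].
-/

set_option autoImplicit false

-- the mandated summit-side namespace repeats a component by design (single-problem summit)
set_option linter.dupNamespace false

noncomputable section

namespace Summit.ValiantsHypothesis.ValiantsHypothesis.Theorems.FifoMatching

namespace StackQueue

open scoped NNReal BigOperators
open MvPolynomial
open Literature.Computability.AlgebraicComplexity

universe u

/-! ## The stack twin over any commutative semiring: DP identity, circuit size, degree -/

section AnySemiring

variable (k : Type u) [CommSemiring k]

open scoped Classical in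
/-- **`NC_n` is the interval-DP value `NC[0,2n)` over any commutative semiring** (first-arc decomposition of noncrossing
perfect matchings; the `ℂ` instance is the tree's `sum_matchings_eq_ncRec`). [cite: ChenDengDuStanleyYan2007, §1] -/
theorem noncrossingMatchingPoly_eq_ncRec (n : ℕ) :
    noncrossingMatchingPoly n k = ncRec k n 0 (2 * n) := by
  have hsum : noncrossingMatchingPoly n k =
      ∑ M ∈ Finset.univ.filter (fun M : Fin (2 * n) → Fin (2 * n) => IsNCOn 0 (2 * n) M), wt k M := by
    rw [noncrossingMatchingPoly_eq_sum_ite, Finset.sum_filter]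
    refine Finset.sum_congr rfl fun M _ => ?_
    by_cases hM : IsNCOn 0 (2 * n) M
    · rw [if_pos hM, if_pos ((isNCOn_zero_iff M).1 hM)]
      rfl
    · rw [if_neg hM, if_neg (fun h => hM ((isNCOn_zero_iff M).2 h))]
  rw [hsum]
  refine sum_wt_eq (ncRec k n) (xv k n) (fun i a hi ha => ?_) (fun i j h => ncRec_of_le n h)
    (fun i j h _ => ?_) (2 * n) 0 (2 * n) (by omega) (Nat.zero_le _) le_rfl
  · unfold xv
    rw [dif_pos ⟨hi, ha⟩]
  · rw [ncRec_of_lt n h]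
    rfl

/-- **`L(NC_n) ≤ 4 (2n+1)³` over any commutative semiring** — in particular the STACK twin has polynomial MONOTONE
circuits (`k = ℝ≥0`): the interval DP compiled to a fan-in-two circuit (`complexity_ncRec_le`).
[cite: Burgisser2000, Def. 2.1] -/
theorem complexity_noncrossingMatchingPoly_le (n : ℕ) :
    complexity (noncrossingMatchingPoly n k) ≤ 4 * (2 * n + 1) ^ 3 := by
  rw [noncrossingMatchingPoly_eq_ncRec]
  exact complexity_ncRec_le (k := k) n

/-- `deg NC_n ≤ 2n` (the DP degree bound `totalDegree_ncRec_le`). [folklore] -/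
theorem totalDegree_noncrossingMatchingPoly_le (n : ℕ) :
    (noncrossingMatchingPoly n k).totalDegree ≤ 2 * n := by
  rw [noncrossingMatchingPoly_eq_ncRec]
  simpa using totalDegree_ncRec_le (k := k) n (2 * n) 0 (2 * n) le_rfl

/-- arithmetic of the exponent: with `ℓ = log₂ n`, `2n < 2^(ℓ+2)`, `4n² ≤ 2^(3ℓ+8)` and `4(2n+1)³ ≤ 2^(3ℓ+8)`. -/
theorem bounds_le_two_pow (n : ℕ) :
    2 * n < 2 ^ (3 * Nat.log 2 n + 8) ∧ (2 * n) * (2 * n) ≤ 2 ^ (3 * Nat.log 2 n + 8) ∧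
      4 * (2 * n + 1) ^ 3 ≤ 2 ^ (3 * Nat.log 2 n + 8) := by
  set ℓ := Nat.log 2 n with hℓ
  have hn : n < 2 ^ (ℓ + 1) := Nat.lt_pow_succ_log_self Nat.one_lt_two n
  have h21 : 2 * n + 1 ≤ 2 ^ (ℓ + 2) := by rw [pow_succ]; omega
  have hcube : (2 * n + 1) ^ 3 ≤ 2 ^ (3 * ℓ + 6) := by
    calc (2 * n + 1) ^ 3 ≤ (2 ^ (ℓ + 2)) ^ 3 := Nat.pow_le_pow_left h21 3
      _ = 2 ^ (3 * ℓ + 6) := by rw [← pow_mul]; ring_nf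
  have h4 : 4 * (2 * n + 1) ^ 3 ≤ 2 ^ (3 * ℓ + 8) := by
    calc 4 * (2 * n + 1) ^ 3 ≤ 4 * 2 ^ (3 * ℓ + 6) := Nat.mul_le_mul_left 4 hcube
      _ = 2 ^ (3 * ℓ + 8) := by ring
  have hsq : (2 * n) * (2 * n) ≤ (2 * n + 1) ^ 3 := by nlinarith
  have hlin : 2 * n < 4 * (2 * n + 1) ^ 3 := by nlinarith
  exact ⟨lt_of_lt_of_le hlin h4, (hsq.trans (Nat.le_mul_of_pos_left _ (by norm_num))).trans h4, h4⟩

/-- ★ **The STACK twin has quasi-polynomial monotone formulas**: over any commutative semiring (in particular `ℝ≥0`),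
`E(NC_n) ≤ 2^{18 (3 log₂ n + 8)²} = n^{O(log n)}` — the polynomial-size DP circuit balanced into a formula by the tree's
BCS theorem `formulaComplexity_le_two_pow` (Brent / Hyafil / Valiant–Skyum–Berkowitz–Rackoff over semirings).
[cite: BurgisserClausenShokrollahi1997, Thm (21.35)/(21.36)] -/
theorem formulaComplexity_noncrossingMatchingPoly_le (n : ℕ) :
    formulaComplexity (noncrossingMatchingPoly n k) ≤ 2 ^ (18 * (3 * Nat.log 2 n + 8) ^ 2) := by
  obtain ⟨hd, hcard, hL⟩ := bounds_le_two_pow n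
  refine formulaComplexity_le_two_pow (totalDegree_noncrossingMatchingPoly_le k n) hd ?_
    ((complexity_noncrossingMatchingPoly_le k n).trans hL) (by omega)
  rw [Fintype.card_prod, Fintype.card_fin]
  exact hcard

end AnySemiring

/-! ## The separation in the monotone formula-with-division model -/

/-- `E(1) = 0`: the constant `1` is a gate-free formula. [cite: BurgisserClausenShokrollahi1997, (21.19)] -/
theorem formulaComplexity_one_eq_zero {k : Type u} [CommSemiring k] {σ : Type*} :
    formulaComplexity (1 : MvPolynomial σ k) = 0 := by
  have h := formulaComplexity_le_size (ArithCircuit.IsFormula.ofConst (σ := σ) (1 : k))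
    (ArithCircuit.IsFanInTwo.ofConst (σ := σ) (1 : k))
    (show (ArithCircuit.ofConst (1 : k) : ArithCircuit k σ).Computes 1 by
      rw [ArithCircuit.Computes, ArithCircuit.eval_ofConst, C_1])
  rw [ArithCircuit.size_ofConst] at h
  omega

/-- arithmetic: `18 (3ℓ + 8)² ≤ (ℓ + 6)^6`. -/
theorem exponent_le_polylog (ℓ : ℕ) : 18 * (3 * ℓ + 8) ^ 2 ≤ (ℓ + 6) ^ 6 := by
  have h0 : (3 * ℓ + 8) ^ 2 ≤ (6 * (ℓ + 6)) ^ 2 := Nat.pow_le_pow_left (by omega) 2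
  have h1 : 18 * (3 * ℓ + 8) ^ 2 ≤ 6 ^ 4 * (ℓ + 6) ^ 2 :=
    calc 18 * (3 * ℓ + 8) ^ 2 ≤ 18 * (6 * (ℓ + 6)) ^ 2 := Nat.mul_le_mul_left _ h0
      _ = 648 * (ℓ + 6) ^ 2 := by ring
      _ ≤ 6 ^ 4 * (ℓ + 6) ^ 2 := Nat.mul_le_mul_right _ (by norm_num)
  have h2 : 6 ^ 4 ≤ (ℓ + 6) ^ 4 := Nat.pow_le_pow_left (by omega) 4
  calc 18 * (3 * ℓ + 8) ^ 2 ≤ 6 ^ 4 * (ℓ + 6) ^ 2 := h1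
    _ ≤ (ℓ + 6) ^ 4 * (ℓ + 6) ^ 2 := Nat.mul_le_mul_right _ h2
    _ = (ℓ + 6) ^ 6 := by ring

/-- ★★ **STACK vs QUEUE, SEPARATED in the monotone formula-with-division model** (Hrubeš–Yehudayoff normal form
`f · h = g`, cost `E₊(f·h) + E₊(h)` over `ℝ≥0`): eventually in `n`,
(i) the stack twin has the certificate `h = 1` of quasi-polynomial cost, `E₊(NC_n · 1) + E₊(1) ≤ 2^{18(3 log₂ n + 8)²}`, while
(ii) EVERY certificate of the queue twin is exponentially expensive: for all `h ≠ 0`,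
`2^{18(3 log₂ n + 8)²} < 2^{⌊n^{1/8}⌋} < E₊(NN_n · h) + E₊(h)` (`⌊n^{1/8}⌋ := Nat.sqrt (Nat.sqrt (Nat.sqrt n))`).
[cite: HrubesYehudayoff2021, Thm 42 and §6] [cite: BurgisserClausenShokrollahi1997, Thm (21.35)/(21.36)] -/
theorem stack_queue_formulaDivision_separation :
    ∃ n₀ : ℕ, ∀ n ≥ n₀,
      formulaComplexity (noncrossingMatchingPoly n ℝ≥0 * 1) +
          formulaComplexity (1 : MvPolynomial (Fin (2 * n) × Fin (2 * n)) ℝ≥0) ≤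
            2 ^ (18 * (3 * Nat.log 2 n + 8) ^ 2) ∧
        2 ^ (18 * (3 * Nat.log 2 n + 8) ^ 2) < 2 ^ Nat.sqrt (Nat.sqrt (Nat.sqrt n)) ∧
        ∀ h : MvPolynomial (Fin (2 * n) × Fin (2 * n)) ℝ≥0, h ≠ 0 →
          2 ^ Nat.sqrt (Nat.sqrt (Nat.sqrt n)) <
            formulaComplexity (nestFreeMatchingPoly n ℝ≥0 * h) + formulaComplexity h := by
  obtain ⟨n₁, hn₁⟩ := FormulaDivision.formulaExpRung_holds
  obtain ⟨n₂, hn₂⟩ := NNDivisionHard.HyperDegree.polylog_le_root8 7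
  refine ⟨max n₁ n₂, fun n hn => ⟨?_, ?_, fun h hh => ?_⟩⟩
  · rw [mul_one, formulaComplexity_one_eq_zero, add_zero]
    exact formulaComplexity_noncrossingMatchingPoly_le ℝ≥0 n
  · refine Nat.pow_lt_pow_right (by norm_num) ?_
    have h6 := exponent_le_polylog (Nat.log 2 n)
    have h7 : (Nat.log 2 n + 6) ^ 6 < (Nat.log 2 n + 7) ^ 7 :=
      calc (Nat.log 2 n + 6) ^ 6 < (Nat.log 2 n + 7) ^ 6 :=
            Nat.pow_lt_pow_left (by omega) (by norm_num)
        _ ≤ (Nat.log 2 n + 7) ^ 7 := Nat.pow_le_pow_right (by omega) (by norm_num)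
    exact lt_of_le_of_lt h6 (lt_of_lt_of_le h7 (hn₂ n (le_of_max_le_right hn)))
  · exact Nat.lt_add_right _ (hn₁ n (le_of_max_le_left hn) h hh)

end StackQueue

end Summit.ValiantsHypothesis.ValiantsHypothesis.Theorems.FifoMatching

end
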